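import Literature.Topology.FourManifolds.MMSWTwistedPictureTransverse
import HarnessLib

/-!
# The crossing set of the picture of a strip-twisted model knot

First step of the explicit DESCRIPTION of the Gauss diagrams of the twisted pictures
`D(0⃗)(stripTwistAt_k ∘ K)` (which are in general position for `k ≥ k₁`,
`MMSWTwistedPictureTransverse.eventually_inGeneralPosition_twisted`), towards the named fact
`Literature.Topology.FourManifolds.MMSW.eventually_approxHasRasmussen` (Manolescu–Marengon–
Sarkar–Willis, arXiv:1910.08195, Thm. 1.4 / Prop. 8.2 (i); §2.1/§8.1 in the tree's picture).
With generic bands (crossing values of `D(0⃗)(K)` off the closed windows), for EVERY `k`: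

* `crossingSet_subset_twisted` — old crossings persist (`crossingSet K₃ ⊆ crossingSet K₃k`),
  with the same partner;
* `mem_crossingSet_of_twisted_of_notMem` — a crossing parameter of the twisted picture whose
  radius `Re z` is outside the open windows is an old crossing parameter;
* `twisted_planeCurve_eq_of_equation` — conversely an upper point `s` and a lower point `t` of a
  band at the same radius satisfying the NEW-CROSSING EQUATION
  `c(s) · conj (stripUnit k w (z(s) - c_j - e_j)) = c(t)` form a double point of the twisted picture;
* `crossingSet_twisted_eq` — **the crossing set of the twisted picture is the disjoint union of
  the old crossing set and the set of window parameters with a solution of the new-crossing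
  equation on the other side of the band** (`disjoint_crossingSet_new`).

Everything is proved; no definitions, no named facts.

## References

* C. Manolescu, M. Marengon, S. Sarkar, M. Willis, Duke Math. J. 172 (2023), arXiv:1910.08195,
  §2.1 and §8.1. [ManolescuMarengonSarkarWillis2023]
* P. R. Cromwell, *Knots and Links*, CUP (2004), §3.2–3.3. [Cromwell2004]
-/

open scoped Manifold ContDiff Topology ComplexConjugate
open Function Set Filter Complex

noncomputable section

namespace Literature.Topology.FourManifolds

/-- Local notation: `𝔼 n` is the model Euclidean space `EuclideanSpace ℝ (Fin n)`. -/
local notation "𝔼 " n:arg => EuclideanSpace ℝ (Fin n)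

/-- Local notation: `𝕊 n` is the unit sphere in `EuclideanSpace ℝ (Fin (n + 1))`. -/
local notation "𝕊 " n:arg => (Metric.sphere (0 : EuclideanSpace ℝ (Fin (n + 1))) 1)

namespace MMSW

open Literature.AlgebraicTopology.Homotopy.HopfFibration (zC wC)

variable {r : ℕ}

/-! ## Old crossings persist -/

/-- At a parameter whose radius is outside the closed windows the twisted picture has the same
point as the original one. [folklore] -/
theorem planeCurve_twisted_eq_of_notMem_closedWindows {K : 𝕊 1 → 𝔼 4} {K₃ K₃k : Knot}
    (hK₃ : ⇑K₃ = finiteApprox r 0 K) {k : ℤ} {w : ℝ} (hw : 0 < w) {e : Fin r → ℝ}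
    (hK₃k : ⇑K₃k = finiteApprox r 0 (stripTwistAt r k w e ∘ K)) {s : ℝ}
    (hs : ∀ j : Fin r, (zC (K (circlePoint s))).re ∉
      Icc ((holeCentre r j).re + e j - w) ((holeCentre r j).re + e j + w)) :
    K₃k.planeCurve s = K₃.planeCurve s :=
  planeCurve_twisted_eq_of_notMem_windows hK₃ hw hK₃k fun j h ↦ hs j (Ioo_subset_Icc_self h)

/-- **Old crossings persist**: a crossing parameter of `D(0⃗)(K)` is a crossing parameter of the
twisted picture, with the same partner parameters. [cite: ManolescuMarengonSarkarWillis2023, §8.1] -/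
theorem crossingSet_subset_twisted {K : 𝕊 1 → 𝔼 4} {K₃ K₃k : Knot}
    (hK₃ : ⇑K₃ = finiteApprox r 0 K) {k : ℤ} {w : ℝ} (hw : 0 < w) {e : Fin r → ℝ}
    (hK₃k : ⇑K₃k = finiteApprox r 0 (stripTwistAt r k w e ∘ K))
    (hcross : ∀ j : Fin r, ∀ s ∈ Knot.crossingSet K₃, (zC (K (circlePoint s))).re ∉
      Icc ((holeCentre r j).re + e j - w) ((holeCentre r j).re + e j + w)) :
    Knot.crossingSet K₃ ⊆ Knot.crossingSet K₃k := by
  have hcross' := hcross_of_crossingSet hcross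
  rintro s ⟨hs, t, hts, hst⟩
  refine ⟨hs, t, hts, ?_⟩
  rw [planeCurve_twisted_eq_of_notMem_closedWindows hK₃ hw hK₃k (hcross' s t hst hts.symm),
    planeCurve_twisted_eq_of_notMem_closedWindows hK₃ hw hK₃k (hcross' t s hst.symm hts), hst]

/-- An old double point is a double point of the twisted picture (parameter form).
[folklore] -/
theorem twisted_planeCurve_eq_of_old {K : 𝕊 1 → 𝔼 4} {K₃ K₃k : Knot}
    (hK₃ : ⇑K₃ = finiteApprox r 0 K) {k : ℤ} {w : ℝ} (hw : 0 < w) {e : Fin r → ℝ}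
    (hK₃k : ⇑K₃k = finiteApprox r 0 (stripTwistAt r k w e ∘ K))
    (hcross : ∀ j : Fin r, ∀ s ∈ Knot.crossingSet K₃, (zC (K (circlePoint s))).re ∉
      Icc ((holeCentre r j).re + e j - w) ((holeCentre r j).re + e j + w))
    {s t : ℝ} (hst : K₃.planeCurve s = K₃.planeCurve t) (hne : circlePoint s ≠ circlePoint t) :
    K₃k.planeCurve s = K₃k.planeCurve t := by
  have hcross' := hcross_of_crossingSet hcross
  rw [planeCurve_twisted_eq_of_notMem_closedWindows hK₃ hw hK₃k (hcross' s t hst hne),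
    planeCurve_twisted_eq_of_notMem_closedWindows hK₃ hw hK₃k (hcross' t s hst.symm hne.symm), hst]

/-! ## Crossings of the twisted picture off the windows are old -/

/-- **A double point of the twisted picture at a radius outside the open windows is an old double
point.** [cite: ManolescuMarengonSarkarWillis2023, §8.1] -/
theorem planeCurve_eq_of_twisted_of_notMem {K : 𝕊 1 → 𝔼 4} (hK : IsModelKnot r K)
    (hwK : ∀ t, wC (K t) ≠ 0) {K₃ K₃k : Knot} (hK₃ : ⇑K₃ = finiteApprox r 0 K) {k : ℤ} {w : ℝ}
    (hw : 0 < w) {e : Fin r → ℝ} (he : ∀ j, |e j| + w < 1)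
    (hK₃k : ⇑K₃k = finiteApprox r 0 (stripTwistAt r k w e ∘ K))
    (hcross : ∀ j : Fin r, ∀ s ∈ Knot.crossingSet K₃, (zC (K (circlePoint s))).re ∉
      Icc ((holeCentre r j).re + e j - w) ((holeCentre r j).re + e j + w))
    {s t : ℝ} (hst : K₃k.planeCurve s = K₃k.planeCurve t) (hne : circlePoint s ≠ circlePoint t)
    (hs : ∀ j : Fin r, (zC (K (circlePoint s))).re ∉
      Ioo ((holeCentre r j).re + e j - w) ((holeCentre r j).re + e j + w)) :
    K₃.planeCurve s = K₃.planeCurve t := by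
  rcases twisted_doublePoint_dichotomy hK hwK hK₃ hw he hK₃k (hcross_of_crossingSet hcross) hst hne
    with ⟨hold, -⟩ | ⟨j, hj, -, -⟩
  · exact hold
  · exact absurd hj (hs j)

/-- Hence a crossing parameter of the twisted picture at a radius outside the open windows is an
old crossing parameter. [folklore] -/
theorem mem_crossingSet_of_twisted_of_notMem {K : 𝕊 1 → 𝔼 4} (hK : IsModelKnot r K)
    (hwK : ∀ t, wC (K t) ≠ 0) {K₃ K₃k : Knot} (hK₃ : ⇑K₃ = finiteApprox r 0 K) {k : ℤ} {w : ℝ}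
    (hw : 0 < w) {e : Fin r → ℝ} (he : ∀ j, |e j| + w < 1)
    (hK₃k : ⇑K₃k = finiteApprox r 0 (stripTwistAt r k w e ∘ K))
    (hcross : ∀ j : Fin r, ∀ s ∈ Knot.crossingSet K₃, (zC (K (circlePoint s))).re ∉
      Icc ((holeCentre r j).re + e j - w) ((holeCentre r j).re + e j + w))
    {s : ℝ} (hsk : s ∈ Knot.crossingSet K₃k)
    (hs : ∀ j : Fin r, (zC (K (circlePoint s))).re ∉
      Ioo ((holeCentre r j).re + e j - w) ((holeCentre r j).re + e j + w)) :
    s ∈ Knot.crossingSet K₃ := by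
  obtain ⟨hs0, t, hts, hst⟩ := hsk
  exact ⟨hs0, t, hts, planeCurve_eq_of_twisted_of_notMem hK hwK hK₃ hw he hK₃k hcross hst hts.symm hs⟩

/-! ## The new crossings: the equation is also sufficient -/

/-- **The new-crossing equation is sufficient**: an upper point `s` of the open window of band `j`
and a lower point `t` at the same radius with `c(s) · conj (stripUnit k w (z(s) - c_j - e_j)) = c(t)`
have the same twisted plane-curve point. [cite: ManolescuMarengonSarkarWillis2023, §8.1] -/
theorem twisted_planeCurve_eq_of_equation {K : 𝕊 1 → 𝔼 4} {K₃ K₃k : Knot}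
    (hK₃ : ⇑K₃ = finiteApprox r 0 K) {k : ℤ} {w : ℝ} (hw : 0 < w) {e : Fin r → ℝ}
    (he : ∀ j, |e j| + w < 1) (hK₃k : ⇑K₃k = finiteApprox r 0 (stripTwistAt r k w e ∘ K))
    {s t : ℝ} {j : Fin r}
    (hj : (zC (K (circlePoint s))).re ∈ Ioo ((holeCentre r j).re + e j - w) ((holeCentre r j).re + e j + w))
    (ht : (zC (K (circlePoint t))).im < 0)
    (heq : chartC (K₃.stereoCurve s) *
        conj (stripUnit k w (zC (K (circlePoint s)) - holeCentre r j - e j)) =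
      chartC (K₃.stereoCurve t)) :
    K₃k.planeCurve s = K₃k.planeCurve t := by
  have h1 : ∀ t, ‖stripMultiplierAt r k w e (zC (K t))‖ = 1 := fun t ↦ norm_stripMultiplierAt _ _ _ _
  have hjs : |(zC (K (circlePoint s))).re - (holeCentre r j).re - e j| < w := by
    rw [abs_lt]; constructor <;> linarith [hj.1, hj.2]
  refine planeCurve_eq_of_chartC_eq ?_
  rw [chartC_stereoCurve_twisted (φ := stripMultiplierAt r k w e) hK₃ hK₃k h1 s,
    chartC_stereoCurve_twisted (φ := stripMultiplierAt r k w e) hK₃ hK₃k h1 t,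
    stripMultiplierAt_eq_stripUnit he hw hjs,
    stripMultiplierAt_eq_one hw fun i ↦ Or.inl ht.le, map_one, mul_one]
  exact heq

/-- Upper and lower points are different points of the circle. [folklore] -/
theorem circlePoint_ne_of_im_sign {K : 𝕊 1 → 𝔼 4} {s t : ℝ}
    (hs : 0 < (zC (K (circlePoint s))).im) (ht : (zC (K (circlePoint t))).im < 0) :
    circlePoint s ≠ circlePoint t := fun h ↦ by
  rw [h] at hs; linarith

/-! ## The crossing set of the twisted picture -/

/-- **The crossing set of the twisted picture**: the old crossing parameters together with the
window parameters admitting a solution of the new-crossing equation on the other side of the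
band. [cite: ManolescuMarengonSarkarWillis2023, §8.1] -/
theorem crossingSet_twisted_eq {K : 𝕊 1 → 𝔼 4} (hK : IsModelKnot r K) (hwK : ∀ t, wC (K t) ≠ 0)
    {K₃ K₃k : Knot} (hK₃ : ⇑K₃ = finiteApprox r 0 K) {k : ℤ} {w : ℝ} (hw : 0 < w)
    {e : Fin r → ℝ} (he : ∀ j, |e j| + w < 1)
    (hK₃k : ⇑K₃k = finiteApprox r 0 (stripTwistAt r k w e ∘ K))
    (hcross : ∀ j : Fin r, ∀ s ∈ Knot.crossingSet K₃, (zC (K (circlePoint s))).re ∉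
      Icc ((holeCentre r j).re + e j - w) ((holeCentre r j).re + e j + w)) :
    Knot.crossingSet K₃k = Knot.crossingSet K₃ ∪
      {s | s ∈ Ico 0 (2 * Real.pi) ∧ ∃ (j : Fin r) (t : ℝ),
        (zC (K (circlePoint s))).re ∈ Ioo ((holeCentre r j).re + e j - w) ((holeCentre r j).re + e j + w) ∧
        (zC (K (circlePoint t))).re = (zC (K (circlePoint s))).re ∧
        ((0 < (zC (K (circlePoint s))).im ∧ (zC (K (circlePoint t))).im < 0 ∧
            chartC (K₃.stereoCurve s) *
                conj (stripUnit k w (zC (K (circlePoint s)) - holeCentre r j - e j)) =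
              chartC (K₃.stereoCurve t)) ∨
          ((zC (K (circlePoint s))).im < 0 ∧ 0 < (zC (K (circlePoint t))).im ∧
            chartC (K₃.stereoCurve t) *
                conj (stripUnit k w (zC (K (circlePoint t)) - holeCentre r j - e j)) =
              chartC (K₃.stereoCurve s)))} := by
  have hcross' := hcross_of_crossingSet hcross
  apply Subset.antisymm
  · rintro s ⟨hs0, t, hts, hst⟩
    by_cases hwin : ∃ j : Fin r, (zC (K (circlePoint s))).re ∈
        Ioo ((holeCentre r j).re + e j - w) ((holeCentre r j).re + e j + w)
    · right
      refine ⟨hs0, ?_⟩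
      rcases twisted_doublePoint_dichotomy hK hwK hK₃ hw he hK₃k hcross' hst hts.symm with
        ⟨-, hoff⟩ | ⟨j, hj, hrad, hsign⟩
      · obtain ⟨j, hj⟩ := hwin
        exact absurd (Ioo_subset_Icc_self hj) (hoff j).1
      · refine ⟨j, t, hj, hrad, ?_⟩
        rcases hsign with ⟨hs, ht⟩ | ⟨hs, ht⟩
        · exact Or.inl ⟨hs, ht, chartC_eq_of_twisted_doublePoint hK₃ hw he hK₃k hst hj ht⟩
        · refine Or.inr ⟨hs, ht, ?_⟩
          have hj' : (zC (K (circlePoint t))).re ∈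
              Ioo ((holeCentre r j).re + e j - w) ((holeCentre r j).re + e j + w) := by rw [hrad]; exact hj
          exact chartC_eq_of_twisted_doublePoint hK₃ hw he hK₃k hst.symm hj' hs
    · left
      push Not at hwin
      exact ⟨hs0, t, hts, planeCurve_eq_of_twisted_of_notMem hK hwK hK₃ hw he hK₃k hcross hst hts.symm hwin⟩
  · rintro s (hs | ⟨hs0, j, t, hj, hrad, hcase⟩)
    · exact crossingSet_subset_twisted hK₃ hw hK₃k hcross hs
    · rcases hcase with ⟨hs, ht, heq⟩ | ⟨hs, ht, heq⟩
      · exact ⟨hs0, t, (circlePoint_ne_of_im_sign hs ht).symm,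
          twisted_planeCurve_eq_of_equation hK₃ hw he hK₃k hj ht heq⟩
      · have hj' : (zC (K (circlePoint t))).re ∈
            Ioo ((holeCentre r j).re + e j - w) ((holeCentre r j).re + e j + w) := by rw [hrad]; exact hj
        exact ⟨hs0, t, circlePoint_ne_of_im_sign ht hs,
          (twisted_planeCurve_eq_of_equation hK₃ hw he hK₃k hj' hs heq).symm⟩

/-- The two parts of the crossing set are disjoint: old crossing parameters have their radius
outside the closed windows. [folklore] -/
theorem notMem_crossingSet_of_mem_window {K : 𝕊 1 → 𝔼 4} {K₃ : Knot} {w : ℝ} {e : Fin r → ℝ}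
    (hcross : ∀ j : Fin r, ∀ s ∈ Knot.crossingSet K₃, (zC (K (circlePoint s))).re ∉
      Icc ((holeCentre r j).re + e j - w) ((holeCentre r j).re + e j + w))
    {s : ℝ} {j : Fin r}
    (hj : (zC (K (circlePoint s))).re ∈ Ioo ((holeCentre r j).re + e j - w) ((holeCentre r j).re + e j + w)) :
    s ∉ Knot.crossingSet K₃ := fun hs ↦ hcross j s hs (Ioo_subset_Icc_self hj)

end MMSW

end Literature.Topology.FourManifolds

end
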